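import Summits.QuantumAdvantage.QuantumAdvantage.Theorems.CubicForrelationNearExactIsExactTenIsolation78B
import Summits.QuantumAdvantage.QuantumAdvantage.Theorems.CubicForrelationNearExactIsExactAffineSliceTypeE

/-!
# Crux `CubicForrelation.NearExactIsExact` (stmt-QuantumAdvantage-14043): the `n = 10`, `θ = 7/8` census —
  the affine-`D` family is empty (kernel-checked), and the sharpened conditional rung

Block-2b certificate seat `b2b-cforr-cert` (2026-08-18).  HONEST FRAMING: the value of this file is a THEOREM about the
finite proposition CENSUS₁₀′ (the hypothesis of `isolation_ten_78_of_census2`), not summit progress.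

What is proved at which `n` (tree status 2026-08-18, all kernel-checked with the standard three axioms unless marked):
* `n ≤ 8`:  `Φ > 7/8 ⇒ Φ = 1` for all cubic pairs — `isolation_eight` (pure proof), `nearExact78_le_six` (`n ≤ 6`, verified
  checker run by `native_decide`, computational).
* `n = 10`: `Φ > 15/16 ⇒ Φ = 1` — `isolation_ten` (pure proof).  `Φ > 7/8 ⇒ Φ = 1` — `isolation_ten_78`
  (…TenIsolation78Final.lean, 2026-08-18: the census hypothesis CENSUS₁₀′ of `isolation_ten_78_of_census2` is DISCHARGED BY
  PROOF, `census10_prime_false`; this file's affine-`D` exclusion was an earlier partial step); `7/8` itself is attained at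
  `n = 10` (`forrelation_fT_gT`, T-family), so `7/8` IS the sharp constant at `n = 10`.  The pure g-side census CENSUS₁₀ is
  FALSE (`Negative/Census10GSide.lean`).
* `n = 16`: `Φ = 15/16 < 1` is attained (`Negative/FifteenSixteenths.lean`), so the crux's `∃ θ < 1` needs `θ ≥ 15/16`
  globally; the "conjectured sharp constant `7/8`" of the 2026-08-16 crux text is refuted as a GLOBAL constant.

This file removes one infinite-looking family from CENSUS₁₀′ by a proof: if `D` has degree `≤ 1` the cell congruences are
contradictory (`census10_no_affine_D`), whatever `Q` and `bh` are; likewise if `D ⊕ Q` has degree `≤ 1`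
(`census10_no_QaffineD`, by relabelling the cells).  Reason: peel the ninth coordinate of the 9-variable
slice `g₉(w ‖ a₀) = E(w) ⊕ a₀·D(w)`: `W_{g₉}(x ‖ a) = W_E(x) + (−1)^a W_{E⊕D}(x) = 2 Σ_{D w = a} (−1)^{E w + w·x}`, and the
last sum is (heavy cell) + (light cell) `= 8·odd + 4·odd ≡ 4 (mod 8)`, so `W_{g₉} ≡ 8 (mod 16)`; but for affine `D`
every `W_{g₉}` is a multiple of `16` (`stub_affineSliceTypeE`, the lead's type lemma).  Hence the sharpened conditional
rung `isolation_ten_78_of_census3`: it suffices to certify CENSUS₁₀′ for `D` of degree EXACTLY `2`.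

The remaining finite census (D genuinely quadratic) was re-run outside Lean by seat 0 (kit j038100–j038103, j038490–5) and
is, since seat 1 (2026-08-18), a THEOREM: `census10_prime_false` (…TenIsolation78Final.lean), so `isolation_ten_78` is unconditional.
-/

set_option linter.dupNamespace false -- D-0017: single-problem summit ⇒ `QuantumAdvantage.QuantumAdvantage` by design

noncomputable section

namespace Summit.QuantumAdvantage.QuantumAdvantage.Theorems.CubicForrelation.NearExactIsExact

open Finset
open Literature.Computability.QuantumComplexity
open Literature.Computability.QuantumComplexity.DerivativeWalsh (W)

/-- `1 + (−1)^a (−1)^d = 2·[d = a]`. [folklore] -/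
theorem cad_one_add_signOf_mul (a d : Bool) :
    1 + signOf a * signOf d = if d = a then (2 : ℝ) else 0 := by
  cases a <;> cases d <;> simp [signOf] <;> norm_num

/-- Peeling identity for the slice `E ⊕ a₀·D`: `W_E(x) + (−1)^a W_{E⊕D}(x) = 2 Σ_{w : D w = a} (−1)^{E w}(−1)^{w·x}`.
[folklore] -/
theorem cad_W_add_signOf_W (E D : (Fin (4 + 4) → Bool) → Bool) (x : Fin (4 + 4) → Bool) (a : Bool) :
    W (fun w => signOf (E w)) x + signOf a * W (fun w => signOf (E w ^^ D w)) x =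
      2 * ∑ w : Fin (4 + 4) → Bool, if D w = a then signOf (E w) * twist w x else 0 := by
  unfold W
  rw [mul_sum, ← sum_add_distrib, mul_sum]
  refine sum_congr rfl fun w _ => ?_
  dsimp only
  rw [signOf_xor]
  have h := cad_one_add_signOf_mul a (D w)
  split_ifs at h ⊢ with hd
  · linear_combination (signOf (E w) * twist w x) * h
  · linear_combination (signOf (E w) * twist w x) * h

/-- Splitting the `D`-cell sum by the value of `Q`: `Σ_{D = a} = Σ_{D = a, Q = bh} + Σ_{D = a, Q = ¬bh}`. [folklore] -/
theorem cad_sum_split_Q (E D Q : (Fin (4 + 4) → Bool) → Bool) (x : Fin (4 + 4) → Bool) (a bh : Bool) :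
    (∑ w : Fin (4 + 4) → Bool, if D w = a then signOf (E w) * twist w x else 0) =
      (∑ w : Fin (4 + 4) → Bool, if (D w = a ∧ Q w = bh) then signOf (E w) * twist w x else 0) +
      (∑ w : Fin (4 + 4) → Bool, if (D w = a ∧ Q w = !bh) then signOf (E w) * twist w x else 0) := by
  rw [← sum_add_distrib]
  refine sum_congr rfl fun w _ => ?_
  by_cases hd : D w = a
  · by_cases hq : Q w = bh
    · simp [hd, hq]
    · have hq' : Q w = !bh := by cases hQ : Q w <;> cases bh <;> simp_all
      simp [hd, hq']
  · simp [hd]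

/-- **The affine-`D` family of CENSUS₁₀′ is empty.** If `E : 𝔽₂⁸ → 𝔽₂` is cubic and `D` has degree `≤ 1`, the cell
congruences of `ten_unbalanced_cells` — every heavy cell sum `Σ_{D=a,Q=bh} (−1)^{E+w·x} = 8·odd` and every light cell
sum `Σ_{D=a,Q=¬bh} = 4·odd` — cannot all hold, for ANY `Q` and `bh`.  Proof: the 9-variable slice
`g₉(w ‖ a₀) = E w ⊕ a₀·D w` has `W_{g₉}(x ‖ a) = 2(8·odd + 4·odd) ≡ 8 (mod 16)`, contradicting `stub_affineSliceTypeE`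
(`W_{g₉} ∈ 16ℤ` when `D` is affine). [this work; lead c6 type lemma] -/
theorem census10_no_affine_D (E D Q : (Fin (4 + 4) → Bool) → Bool) (bh : Bool)
    (hE : IsDegLeFun 3 E) (hD : IsDegLeFun 1 D)
    (hH : ∀ (a : Bool) (x : Fin (4 + 4) → Bool), ∃ k : ℤ,
      (∑ w : Fin (4 + 4) → Bool, if (D w = a ∧ Q w = bh) then signOf (E w) * twist w x else 0) = 8 * (2 * (k : ℝ) + 1))
    (hL : ∀ (a : Bool) (x : Fin (4 + 4) → Bool), ∃ k : ℤ,
      (∑ w : Fin (4 + 4) → Bool, if (D w = a ∧ Q w = !bh) then signOf (E w) * twist w x else 0) = 4 * (2 * (k : ℝ) + 1)) :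
    False := by
  -- the 9-variable slice
  set g₉ : (Fin (4 + 4 + 1) → Bool) → Bool := fun y => E (Fin.init y) ^^ (y (Fin.last _) && D (Fin.init y)) with hg₉
  have hg : ∀ (w : Fin (4 + 4) → Bool) (a₀ : Bool), g₉ (Fin.snoc w a₀) = (E w ^^ (a₀ && D w)) := by
    intro w a₀
    have h1 : Fin.init (Fin.snoc w a₀ : Fin (4 + 4 + 1) → Bool) = w := Fin.init_snoc _ _
    have h2 : (Fin.snoc w a₀ : Fin (4 + 4 + 1) → Bool) (Fin.last _) = a₀ := Fin.snoc_last _ _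
    simp only [hg₉, h1, h2]
  -- evaluate the Walsh coefficient at `(0 ‖ false)` in two ways
  let x : Fin (4 + 4) → Bool := fun _ => false
  obtain ⟨k, hk⟩ := stub_affineSliceTypeE E D g₉ hE hD hg (Fin.snoc x false)
  obtain ⟨k₁, hk₁⟩ := hH false x
  obtain ⟨k₂, hk₂⟩ := hL false x
  have hpeel := ast_W_snoc E D g₉ hg x false
  rw [cad_W_add_signOf_W, cad_sum_split_Q E D Q x false bh, hk₁, hk₂, hk] at hpeel
  -- `16 k = 2 (8(2k₁+1) + 4(2k₂+1))` is impossible in `ℤ`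
  have hZ : (16 * k : ℤ) = 2 * (8 * (2 * k₁ + 1) + 4 * (2 * k₂ + 1)) := by exact_mod_cast hpeel
  omega


/-- Relabelling the cells: the cell system of `(E, D ⊕ Q, Q, bh)` is that of `(E, D, Q, bh)` with the `D`-label `a` replaced
by `a ⊕ b` on the `Q = b` side. [folklore] -/
theorem cad_sum_relabel (E D Q : (Fin (4 + 4) → Bool) → Bool) (x : Fin (4 + 4) → Bool) (a b : Bool) :
    (∑ w : Fin (4 + 4) → Bool, if ((D w ^^ Q w) = a ∧ Q w = b) then signOf (E w) * twist w x else 0) =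
      (∑ w : Fin (4 + 4) → Bool, if (D w = (a ^^ b) ∧ Q w = b) then signOf (E w) * twist w x else 0) := by
  refine sum_congr rfl fun w _ => ?_
  have hiff : ((D w ^^ Q w) = a ∧ Q w = b) ↔ (D w = (a ^^ b) ∧ Q w = b) := by
    cases hd : D w <;> cases hq : Q w <;> cases a <;> cases b <;> simp
  simp only [hiff]

/-- **The `Q ⊕ affine` family of CENSUS₁₀′ is empty too.** If `D ⊕ Q` has degree `≤ 1` the cell congruences are
contradictory: relabel the cells (`cad_sum_relabel`) and apply `census10_no_affine_D` to `(E, D ⊕ Q, Q, bh)`.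
[this work; lead c6 type lemma] -/
theorem census10_no_QaffineD (E D Q : (Fin (4 + 4) → Bool) → Bool) (bh : Bool)
    (hE : IsDegLeFun 3 E) (hDQ : IsDegLeFun 1 (fun w => D w ^^ Q w))
    (hH : ∀ (a : Bool) (x : Fin (4 + 4) → Bool), ∃ k : ℤ,
      (∑ w : Fin (4 + 4) → Bool, if (D w = a ∧ Q w = bh) then signOf (E w) * twist w x else 0) = 8 * (2 * (k : ℝ) + 1))
    (hL : ∀ (a : Bool) (x : Fin (4 + 4) → Bool), ∃ k : ℤ,
      (∑ w : Fin (4 + 4) → Bool, if (D w = a ∧ Q w = !bh) then signOf (E w) * twist w x else 0) = 4 * (2 * (k : ℝ) + 1)) :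
    False := by
  refine census10_no_affine_D E (fun w => D w ^^ Q w) Q bh hE hDQ ?_ ?_
  · intro a x
    obtain ⟨k, hk⟩ := hH (a ^^ bh) x
    exact ⟨k, by rw [cad_sum_relabel, hk]⟩
  · intro a x
    obtain ⟨k, hk⟩ := hL (a ^^ !bh) x
    exact ⟨k, by rw [cad_sum_relabel, hk]⟩

/-- **Isolation at `7/8` on 10 bits, modulo the census restricted to genuinely quadratic `D`** (CENSUS₁₀″).  If no
`(E, D, Q, bh)` with `E` cubic, `D` quadratic with NEITHER `D` NOR `D ⊕ Q` of degree `≤ 1`, `Q` quadratic unbalanced of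
bias `< 128`,
satisfying the heavy/light cell congruences, admits a cubic partner `f₁` with `Φ(f₁, g_{E,D,Q}) > 7/8`, then
`Φ(f,g) > 7/8 ⇒ Φ(f,g) = 1` for all cubic `f, g : 𝔽₂¹⁰ → 𝔽₂`.  The families `D` affine / `D ⊕ Q` affine are
discharged by `census10_no_affine_D` / `census10_no_QaffineD`; the rest is discharged by `census10_prime_false` (…TenIsolation78Final.lean, 2026-08-18), which makes `isolation_ten_78` unconditional.
[this work; lead c6 `isolation_ten_78_of_census2`] -/
theorem isolation_ten_78_of_census3 :
    (∀ (E D Q : (Fin (4 + 4) → Bool) → Bool) (bh : Bool) (f₁ : (Fin (4 + 4 + 1 + 1) → Bool) → Bool),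
      IsDegLeFun 3 E → IsDegLeFun 2 D → ¬ IsDegLeFun 1 D → ¬ IsDegLeFun 1 (fun w => D w ^^ Q w) →
      IsDegLeFun 2 Q → IsDegLeFun 3 f₁ →
      (∑ w, signOf (Q w)) ≠ 0 → |∑ w, signOf (Q w)| < 128 →
      (∀ (a : Bool) (x : Fin (4 + 4) → Bool), ∃ k : ℤ,
        (∑ w : Fin (4 + 4) → Bool, if (D w = a ∧ Q w = bh) then signOf (E w) * twist w x else 0) = 8 * (2 * (k : ℝ) + 1)) →
      (∀ (a : Bool) (x : Fin (4 + 4) → Bool), ∃ k : ℤ,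
        (∑ w : Fin (4 + 4) → Bool, if (D w = a ∧ Q w = !bh) then signOf (E w) * twist w x else 0) = 4 * (2 * (k : ℝ) + 1)) →
      7 / 8 < forrelation f₁ (fun y : Fin (4 + 4 + 1 + 1) → Bool =>
            E (fun i : Fin (4 + 4) => y (Fin.castLE (by omega) i)) ^^
              (y ⟨8, by norm_num⟩ && D (fun i : Fin (4 + 4) => y (Fin.castLE (by omega) i))) ^^
              (y ⟨9, by norm_num⟩ && Q (fun i : Fin (4 + 4) => y (Fin.castLE (by omega) i)))) → False) →
    ∀ f g : (Fin (4 + 4 + 1 + 1) → Bool) → Bool, IsDegLeFun 3 f → IsDegLeFun 3 g →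
      7 / 8 < forrelation f g → forrelation f g = 1 := by
  intro hcensus
  refine isolation_ten_78_of_census2 ?_
  intro E D Q bh f₁ hE hD hQ hf₁ hQne hQlt hH hL hΦ
  by_cases hD1 : IsDegLeFun 1 D
  · exact census10_no_affine_D E D Q bh hE hD1 hH hL
  by_cases hDQ : IsDegLeFun 1 (fun w => D w ^^ Q w)
  · exact census10_no_QaffineD E D Q bh hE hDQ hH hL
  · exact hcensus E D Q bh f₁ hE hD hD1 hDQ hQ hf₁ hQne hQlt hH hL hΦ

end Summit.QuantumAdvantage.QuantumAdvantage.Theorems.CubicForrelation.NearExactIsExact
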